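import Mathlib
import HarnessLib.Audit
import Summits.PneNP.PneNP.Theorems.PstarReaderCoreSystem
import Summits.PneNP.PneNP.Theorems.PstarGSystemFreeVar
import Summits.PneNP.PneNP.Theorems.PstarGSystemFold

/-!
# The terminal normal form of a minimal infeasible pair (ROUND-24, GAPTWO-PLAN §4 S1 `terminal_form`)

FRONTIER range-avoidance ladder, rung F-N3, ROUND 24 (cell `pnp-ideate`; restricted-model proof complexity — nothing here bears
on `P` versus `NP`).

Planner item S1 of `GAPTWO-PLAN.md` (p3 g19, §1/§4): from a minimal infeasible pair `(J, W)` (`PstarGapLemma.MinInfeasible`, any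
number of parity constraints) on a pure typed instance, exhaustive FOLDING of outputs with a private XOR slot (`PstarGSystemFold`) and
ROW REDUCTION at free constraint variables (`PstarGSystemFreeVar`) produce a CORE `J₀ ⊆ J` and a G-constraint system `𝒲` with
(`terminal_form`):

* (T1) no XOR slot of an output of `J₀` is `J₀`-private;
* (T2′) every variable of the linear part of a constraint is read by an output of `J₀` or is an AND slot of a monomial output
  (so XOR-type constraint variables are read by the core; AND-type ones may sit only in folded outputs — e.g. a star centre);
* (T3) the core is unsolvable together with `𝒲`, but (M0) solvable after deleting any one core output;
* (M′) for every folded output `g ∈ J ∖ J₀` some solution of the core satisfies exactly the constraints whose monomial set avoids `g`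
  (the per-output flip property; it implies the planner's global (M1)/(M2)/(M12) and the COVERAGE `J ∖ J₀ = ⋃ G_w`, `mem_monomials`);
* bookkeeping: `|𝒲| ≤ |W|`, monomial sets `⊆ J ∖ J₀`, hence (T4) `|J| = |J₀| + |J ∖ J₀|` with every folded output a monomial.

The invariant (`Inv`) is established for `(J, W)` itself (`inv_init`), preserved by a fold (`inv_fold`) and by a row reduction
(`inv_elim`), and the measure `|J₀| + |𝒲|` drops at each step (`exists_terminal`).  Boundary expansion, simple overlaps and degree
bounds play no role here; they enter in S2–S4.
-/

set_option linter.dupNamespace false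

open Finset Literature.Computability.Complexity
open scoped symmDiff
open Summit.PneNP.PneNP.Theorems.PstarPDT (parity)
open Summit.PneNP.PneNP.Theorems.PstarTyped (Typed)
open Summit.PneNP.PneNP.Theorems.PstarSALevel (varSet bdry)
open Summit.PneNP.PneNP.Theorems.PstarGapLemma (Sat Feasible MinInfeasible)
open Summit.PneNP.PneNP.Theorems.PstarGapPeeling (not_mem_varSet_of_private eval_update_of_not_mem)
open Summit.PneNP.PneNP.Theorems.PstarCentreFree (vars_mem_varSet)
open Summit.PneNP.PneNP.Theorems.PstarGapOneAll (gval gval_empty)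
open Summit.PneNP.PneNP.Theorems.PstarGConstraint (gval_reader)
open Summit.PneNP.PneNP.Theorems.PstarReaderCoreSystem (ofParity gholds_ofParity_iff)
open Summit.PneNP.PneNP.Theorems.PstarGSystemFreeVar (gval_symmDiff pivotG elimG card_elimG_lt monomials_elimG solves_iff_elimG)
open Summit.PneNP.PneNP.Theorems.PstarGSystemFold (fold not_mem_fold mem_fold_monomials gval_fold_iff_of_solves solves_iff_fold)

namespace Summit.PneNP.PneNP.Theorems.PstarGapTwoTerminal

variable {n m : ℕ}

/-! ## The invariant of the normalisation -/

/-- The invariant carried by the normalisation of `(J, W)`: current core `J₀` and G-constraint system `𝒲`. -/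
structure Inv (I : LocalMap 4 n m) (y : Fin m → Bool) (J : Finset (Fin m)) (h : ℕ) (J₀ : Finset (Fin m))
    (𝒲 : Finset (Finset (Fin n) × Finset (Fin m) × Bool)) : Prop where
  /-- the core lies in `J` -/
  sub : J₀ ⊆ J
  /-- at most `h` constraints -/
  card_le : 𝒲.card ≤ h
  /-- monomial outputs are folded outputs -/
  mono : ∀ w ∈ 𝒲, w.2.1 ⊆ J \ J₀
  /-- (T3) the core is unsolvable with the system -/
  unsat : ¬ ∃ z : Fin n → Bool, (∀ j ∈ J₀, I.eval z j = y j) ∧ ∀ w ∈ 𝒲, gval I w.1 w.2.1 z = w.2.2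
  /-- (M0) deleting a core output makes it solvable -/
  min0 : ∀ f ∈ J₀, ∃ z : Fin n → Bool, (∀ j ∈ J₀.erase f, I.eval z j = y j) ∧ ∀ w ∈ 𝒲, gval I w.1 w.2.1 z = w.2.2
  /-- (M′) a folded output flips exactly the constraints whose monomial set contains it -/
  flip : ∀ g ∈ J \ J₀, ∃ z : Fin n → Bool, (∀ j ∈ J₀, I.eval z j = y j) ∧
    ∀ w ∈ 𝒲, (gval I w.1 w.2.1 z = w.2.2 ↔ g ∉ w.2.1)

/-- **Initialisation**: a minimal infeasible `(J, W)` satisfies the invariant with core `J` and the parity system itself. -/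
theorem inv_init (I : LocalMap 4 n m) (y : Fin m → Bool) {W : Finset (Finset (Fin n) × Bool)} {J : Finset (Fin m)}
    (hmin : MinInfeasible I y W J) : Inv I y J W.card J (W.image (ofParity m)) := by
  classical
  refine ⟨Subset.rfl, card_image_le, fun w hw => ?_, ?_, fun f hf => ?_, fun g hg => ?_⟩
  · obtain ⟨w₀, -, rfl⟩ := mem_image.1 hw
    exact empty_subset _
  · rintro ⟨z, hzJ, hzW⟩
    exact hmin.1 ⟨z, (gholds_ofParity_iff I W z).1 hzW, hzJ⟩
  · obtain ⟨z, hzW, hzJ⟩ := hmin.2 f hf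
    exact ⟨z, hzJ, (gholds_ofParity_iff I W z).2 hzW⟩
  · exact absurd hg (by simp)

/-! ## Pointwise truth of pivoted and folded constraints -/

/-- A pivoted constraint holds iff the original and the pivot have the same truth value (when the pivot applies). -/
theorem pivotG_holds_iff (I : LocalMap 4 n m) {v : Fin n} (w₀ w : Finset (Fin n) × Finset (Fin m) × Bool) (z : Fin n → Bool)
    (hv : v ∈ w.1) :
    gval I (pivotG v w₀ w).1 (pivotG v w₀ w).2.1 z = (pivotG v w₀ w).2.2 ↔
      (gval I w.1 w.2.1 z = w.2.2 ↔ gval I w₀.1 w₀.2.1 z = w₀.2.2) := by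
  unfold PstarGSystemFreeVar.pivotG
  rw [if_pos hv]
  simp only [gval_symmDiff]
  cases gval I w.1 w.2.1 z <;> cases w.2.2 <;> cases gval I w₀.1 w₀.2.1 z <;> cases w₀.2.2 <;> simp

/-- Membership of the pivot monomial set. -/
theorem mem_pivotG_monomials_iff {v : Fin n} (w₀ w : Finset (Fin n) × Finset (Fin m) × Bool) (hv : v ∈ w.1) (g : Fin m) :
    g ∈ (pivotG v w₀ w).2.1 ↔ ¬ (g ∈ w.2.1 ↔ g ∈ w₀.2.1) := by
  unfold PstarGSystemFreeVar.pivotG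
  rw [if_pos hv]
  simp only [mem_symmDiff]
  tauto

/-- Membership of the folded monomial set. -/
theorem mem_fold_monomials_iff (I : LocalMap 4 n m) (y : Fin m → Bool) (f : Fin m) (t : Fin n)
    (w : Finset (Fin n) × Finset (Fin m) × Bool) (g : Fin m) :
    g ∈ (fold I y f t w).2.1 ↔ (t ∈ w.1 ∧ g = f) ∨ g ∈ w.2.1 := by
  unfold PstarGSystemFold.fold
  split_ifs with h
  · simp only [mem_insert, h, true_and]
  · simp only [h, false_and, false_or]

/-- On an assignment that VIOLATES `f` and satisfies `w`, the folded constraint holds iff the fold did not apply. -/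
theorem fold_holds_iff_of_violates (I : LocalMap 4 n m) (hI : I.IsPure xorAndPred) (y : Fin m → Bool) {f : Fin m} (t : Fin n)
    (w : Finset (Fin n) × Finset (Fin m) × Bool) (hf : f ∉ w.2.1) {z : Fin n → Bool} (hz : I.eval z f ≠ y f)
    (hw : gval I w.1 w.2.1 z = w.2.2) :
    gval I (fold I y f t w).1 (fold I y f t w).2.1 z = (fold I y f t w).2.2 ↔ t ∉ w.1 := by
  unfold PstarGSystemFold.fold
  split_ifs with h
  · simp only [gval_reader I hI w.1 hf z, hw, h, not_true_eq_false, iff_false]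
    revert hz
    cases I.eval z f <;> cases y f <;> cases w.2.2 <;> simp
  · simp only [hw, h, not_false_eq_true]

/-! ## The two steps preserve the invariant -/

/-- **Fold step.**  Folding a core output through a `J₀`-private XOR slot preserves the invariant (typed pure instance). -/
theorem inv_fold (I : LocalMap 4 n m) (hI : I.IsPure xorAndPred) (hT : Typed I) (y : Fin m → Bool) {J : Finset (Fin m)} {h : ℕ}
    {J₀ : Finset (Fin m)} {𝒲 : Finset (Finset (Fin n) × Finset (Fin m) × Bool)} (hinv : Inv I y J h J₀ 𝒲)
    {f : Fin m} (hf : f ∈ J₀) {s : Fin 4} (hs : s.val < 2) (hpriv : I.vars f s ∈ bdry I J₀) :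
    Inv I y J h (J₀.erase f) (𝒲.image (fold I y f (I.vars f s))) := by
  classical
  have hprivJ : ∀ j ∈ J₀, j ≠ f → I.vars f s ∉ varSet I j := fun j hj hne =>
    not_mem_varSet_of_private I hf hj hne hpriv (vars_mem_varSet I f s)
  have hfG : ∀ w ∈ 𝒲, f ∉ w.2.1 := fun w hw hfw => (mem_sdiff.1 (hinv.mono w hw hfw)).2 hf
  refine ⟨(erase_subset f J₀).trans hinv.sub, card_image_le.trans hinv.card_le, fun w' hw' g hg => ?_, ?_, fun f' hf' => ?_,
    fun g hg => ?_⟩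
  · -- monomials
    obtain ⟨w, hw, rfl⟩ := mem_image.1 hw'
    rcases mem_fold_monomials I y f (I.vars f s) w hg with h1 | h1
    · have := hinv.mono w hw h1
      rw [mem_sdiff] at this ⊢
      exact ⟨this.1, fun h2 => this.2 (mem_of_mem_erase h2)⟩
    · rw [h1]
      exact mem_sdiff.2 ⟨hinv.sub hf, notMem_erase f J₀⟩
  · -- unsat
    rw [← solves_iff_fold I hI hT y hf hs hprivJ 𝒲 hfG]
    exact hinv.unsat
  · -- (M0)
    have hf'J : f' ∈ J₀ := mem_of_mem_erase hf'
    have hff' : f' ≠ f := ne_of_mem_erase hf'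
    have hfJ' : f ∈ J₀.erase f' := mem_erase.2 ⟨hff'.symm, hf⟩
    have h1 := hinv.min0 f' hf'J
    rw [solves_iff_fold I hI hT y hfJ' hs (fun j hj hne => hprivJ j (mem_of_mem_erase hj) hne) 𝒲 hfG] at h1
    rwa [erase_right_comm] at h1
  · -- (M′)
    rw [mem_sdiff, mem_erase, not_and_or, not_not] at hg
    obtain ⟨hgJ, hg⟩ := hg
    by_cases hgf : g = f
    · subst hgf
      obtain ⟨z, hzJ, hz𝒲⟩ := hinv.min0 g hf
      have hviol : I.eval z g ≠ y g := fun hok =>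
        hinv.unsat ⟨z, fun j hj => if hjg : j = g then hjg ▸ hok else hzJ j (mem_erase.2 ⟨hjg, hj⟩), hz𝒲⟩
      refine ⟨z, hzJ, fun w' hw' => ?_⟩
      obtain ⟨w, hw, rfl⟩ := mem_image.1 hw'
      rw [fold_holds_iff_of_violates I hI y (I.vars g s) w (hfG w hw) hviol (hz𝒲 w hw), mem_fold_monomials_iff]
      simp only [hfG w hw, or_false, and_true]
    · have hgJ₀ : g ∉ J₀ := by
        rcases hg with h | h
        · exact absurd h hgf
        · exact h
      obtain ⟨z, hzJ, hz𝒲⟩ := hinv.flip g (mem_sdiff.2 ⟨hgJ, hgJ₀⟩)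
      refine ⟨z, fun j hj => hzJ j (mem_of_mem_erase hj), fun w' hw' => ?_⟩
      obtain ⟨w, hw, rfl⟩ := mem_image.1 hw'
      rw [gval_fold_iff_of_solves I hI y (I.vars f s) w (hfG w hw) (hzJ f hf), hz𝒲 w hw, mem_fold_monomials_iff]
      simp only [hgf, and_false, false_or]

/-- **Row-reduction step.**  Pivoting the system at a variable read by no core output and no monomial slot preserves the invariant. -/
theorem inv_elim (I : LocalMap 4 n m) (y : Fin m → Bool) {J : Finset (Fin m)} {h : ℕ} {J₀ : Finset (Fin m)}
    {𝒲 : Finset (Finset (Fin n) × Finset (Fin m) × Bool)} (hinv : Inv I y J h J₀ 𝒲) {w₀ : Finset (Fin n) × Finset (Fin m) × Bool}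
    (hw₀ : w₀ ∈ 𝒲) {v : Fin n} (hv : v ∈ w₀.1) (hvJ : ∀ j ∈ J₀, v ∉ varSet I j)
    (hvG : ∀ w ∈ 𝒲, ∀ g ∈ w.2.1, I.vars g 2 ≠ v ∧ I.vars g 3 ≠ v) : Inv I y J h J₀ (elimG 𝒲 w₀ v) := by
  classical
  refine ⟨hinv.sub, (card_elimG_lt hw₀ v).le.trans hinv.card_le, fun w' hw' g hg => ?_, ?_, fun f hf => ?_, fun g hg => ?_⟩
  · obtain ⟨w, hw, hg'⟩ := monomials_elimG hw₀ hw' hg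
    exact hinv.mono w hw hg'
  · rw [← solves_iff_elimG I y hw₀ hv hvJ hvG]
    exact hinv.unsat
  · rw [← solves_iff_elimG I y hw₀ hv (fun j hj => hvJ j (mem_of_mem_erase hj)) hvG]
    exact hinv.min0 f hf
  · obtain ⟨z, hzJ, hz𝒲⟩ := hinv.flip g hg
    refine ⟨z, hzJ, fun w' hw' => ?_⟩
    unfold PstarGSystemFreeVar.elimG at hw'
    obtain ⟨w, hw, rfl⟩ := mem_image.1 hw'
    have hw𝒲 : w ∈ 𝒲 := mem_of_mem_erase hw
    by_cases hvw : v ∈ w.1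
    · rw [pivotG_holds_iff I w₀ w z hvw, hz𝒲 w hw𝒲, hz𝒲 w₀ hw₀, mem_pivotG_monomials_iff w₀ w hvw]
      tauto
    · unfold PstarGSystemFreeVar.pivotG
      rw [if_neg hvw]
      exact hz𝒲 w hw𝒲

/-! ## The iteration -/

/-- **Normalisation.**  From any state satisfying the invariant, folds and row reductions reach a state satisfying the invariant,
(T1) and (T2′). -/
theorem exists_terminal (I : LocalMap 4 n m) (hI : I.IsPure xorAndPred) (hT : Typed I) (y : Fin m → Bool) {J : Finset (Fin m)}
    {h : ℕ} : ∀ (N : ℕ) (J₀ : Finset (Fin m)) (𝒲 : Finset (Finset (Fin n) × Finset (Fin m) × Bool)),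
      J₀.card + 𝒲.card ≤ N → Inv I y J h J₀ 𝒲 →
      ∃ (J₁ : Finset (Fin m)) (𝒲₁ : Finset (Finset (Fin n) × Finset (Fin m) × Bool)), Inv I y J h J₁ 𝒲₁ ∧
        (∀ f ∈ J₁, ∀ s : Fin 4, s.val < 2 → I.vars f s ∉ bdry I J₁) ∧
        (∀ w ∈ 𝒲₁, ∀ v ∈ w.1, (∃ f ∈ J₁, v ∈ varSet I f) ∨ ∃ w' ∈ 𝒲₁, ∃ g ∈ w'.2.1, I.vars g 2 = v ∨ I.vars g 3 = v) := by
  classical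
  intro N
  induction N with
  | zero =>
    intro J₀ 𝒲 hN hinv
    have hJ₀ : J₀ = ∅ := card_eq_zero.1 (by omega)
    have h𝒲 : 𝒲 = ∅ := card_eq_zero.1 (by omega)
    subst hJ₀; subst h𝒲
    exact ⟨∅, ∅, hinv, by simp, by simp⟩
  | succ N ih =>
    intro J₀ 𝒲 hN hinv
    by_cases hstep1 : ∃ f ∈ J₀, ∃ s : Fin 4, s.val < 2 ∧ I.vars f s ∈ bdry I J₀
    · obtain ⟨f, hf, s, hs, hpriv⟩ := hstep1
      have hinv' := inv_fold I hI hT y hinv hf hs hpriv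
      refine ih _ _ ?_ hinv'
      have h1 : (J₀.erase f).card < J₀.card := card_erase_lt_of_mem hf
      have h2 : (𝒲.image (fold I y f (I.vars f s))).card ≤ 𝒲.card := card_image_le
      omega
    by_cases hstep2 : ∃ w₀ ∈ 𝒲, ∃ v ∈ w₀.1, (∀ j ∈ J₀, v ∉ varSet I j) ∧ ∀ w ∈ 𝒲, ∀ g ∈ w.2.1, I.vars g 2 ≠ v ∧ I.vars g 3 ≠ v
    · obtain ⟨w₀, hw₀, v, hv, hvJ, hvG⟩ := hstep2
      have hinv' := inv_elim I y hinv hw₀ hv hvJ hvG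
      refine ih _ _ ?_ hinv'
      have h1 := card_elimG_lt hw₀ v
      omega
    · push Not at hstep1
      refine ⟨J₀, 𝒲, hinv, fun f hf s hs => hstep1 f hf s hs, fun w hw v hv => ?_⟩
      by_contra hno
      push Not at hno
      exact hstep2 ⟨w, hw, v, hv, hno.1, hno.2⟩

/-! ## The terminal form -/

/-- **Coverage**: under the invariant every folded output is a monomial of some constraint (from (T3) and (M′)). -/
theorem mem_monomials (I : LocalMap 4 n m) (y : Fin m → Bool) {J : Finset (Fin m)} {h : ℕ} {J₀ : Finset (Fin m)}
    {𝒲 : Finset (Finset (Fin n) × Finset (Fin m) × Bool)} (hinv : Inv I y J h J₀ 𝒲) {g : Fin m} (hg : g ∈ J \ J₀) :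
    ∃ w ∈ 𝒲, g ∈ w.2.1 := by
  by_contra hno
  push Not at hno
  obtain ⟨z, hzJ, hz𝒲⟩ := hinv.flip g hg
  exact hinv.unsat ⟨z, hzJ, fun w hw => (hz𝒲 w hw).2 (hno w hw)⟩

/-- **S1 — the terminal normal form.**  Every minimal infeasible `(J, W)` on a pure typed instance has a core `J₀ ⊆ J` and a
G-constraint system `𝒲` with `|𝒲| ≤ |W|`, monomial sets inside `J ∖ J₀` and covering it, satisfying (T1), (T2′), (T3), (M0), (M′). -/
theorem terminal_form (I : LocalMap 4 n m) (hI : I.IsPure xorAndPred) (hT : Typed I) (y : Fin m → Bool)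
    (W : Finset (Finset (Fin n) × Bool)) (J : Finset (Fin m)) (hmin : MinInfeasible I y W J) :
    ∃ (J₀ : Finset (Fin m)) (𝒲 : Finset (Finset (Fin n) × Finset (Fin m) × Bool)),
      J₀ ⊆ J ∧ 𝒲.card ≤ W.card ∧ (∀ w ∈ 𝒲, w.2.1 ⊆ J \ J₀) ∧ (∀ g ∈ J \ J₀, ∃ w ∈ 𝒲, g ∈ w.2.1) ∧
      (∀ f ∈ J₀, ∀ s : Fin 4, s.val < 2 → I.vars f s ∉ bdry I J₀) ∧
      (∀ w ∈ 𝒲, ∀ v ∈ w.1, (∃ f ∈ J₀, v ∈ varSet I f) ∨ ∃ w' ∈ 𝒲, ∃ g ∈ w'.2.1, I.vars g 2 = v ∨ I.vars g 3 = v) ∧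
      (¬ ∃ z : Fin n → Bool, (∀ j ∈ J₀, I.eval z j = y j) ∧ ∀ w ∈ 𝒲, gval I w.1 w.2.1 z = w.2.2) ∧
      (∀ f ∈ J₀, ∃ z : Fin n → Bool, (∀ j ∈ J₀.erase f, I.eval z j = y j) ∧ ∀ w ∈ 𝒲, gval I w.1 w.2.1 z = w.2.2) ∧
      (∀ g ∈ J \ J₀, ∃ z : Fin n → Bool, (∀ j ∈ J₀, I.eval z j = y j) ∧
        ∀ w ∈ 𝒲, (gval I w.1 w.2.1 z = w.2.2 ↔ g ∉ w.2.1)) := by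
  classical
  obtain ⟨J₀, 𝒲, hinv, hT1, hT2⟩ := exists_terminal I hI hT y (h := W.card) _ J (W.image (ofParity m)) le_rfl (inv_init I y hmin)
  exact ⟨J₀, 𝒲, hinv.sub, hinv.card_le, hinv.mono, fun g hg => mem_monomials I y hinv hg, hT1, hT2, hinv.unsat, hinv.min0,
    hinv.flip⟩

/-- **XOR-type constraint variables are read by the core** (consequence of (T2′) on a typed instance): a variable of a linear part
that is an XOR slot of ANY output is read by some output of `J₀`. -/
theorem xor_var_read (I : LocalMap 4 n m) (hT : Typed I) {J₀ : Finset (Fin m)}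
    {𝒲 : Finset (Finset (Fin n) × Finset (Fin m) × Bool)}
    (hT2 : ∀ w ∈ 𝒲, ∀ v ∈ w.1, (∃ f ∈ J₀, v ∈ varSet I f) ∨ ∃ w' ∈ 𝒲, ∃ g ∈ w'.2.1, I.vars g 2 = v ∨ I.vars g 3 = v)
    {w : Finset (Fin n) × Finset (Fin m) × Bool} (hw : w ∈ 𝒲) {j : Fin m} {s : Fin 4} (hs : s.val < 2) (hv : I.vars j s ∈ w.1) :
    ∃ f ∈ J₀, I.vars j s ∈ varSet I f := by
  rcases hT2 w hw _ hv with h | ⟨w', -, g, -, hg⟩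
  · exact h
  · exfalso
    rcases hg with h | h
    · exact hT j g s 2 hs (by decide) h.symm
    · exact hT j g s 3 hs (by decide) h.symm

end Summit.PneNP.PneNP.Theorems.PstarGapTwoTerminal
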